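import Literature.Probability.LatticeModels.DelaunayGraph
import Literature.Analysis.FunctionSpaces.PoissonMecke
import HarnessLib

/-!
# Poisson–Voronoi cells are a.s. bounded; the Poisson–Delaunay graph is a.s. locally finite

Topic `Probability/LatticeModels`; theorem-only. Input (iii) of the construction fact
`stub_flatMeasurable` (F2) of line `birth` of the crux `DeviceWeylUniversality` of route
`CriticalPhenomena/Ising3DConformalLimit/ConformalPoissonDevice` (stmt-CriticalPhenomena-4722), and the
non-junk condition of `finVolExpect` / `pdCorr` (`PoissonDelaunayIsing.lean`): the finite-volume Gibbs
expectations on the Delaunay graph of a configuration are genuine only when that graph is locally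
finite, which the tree's `PointConfig.delaunayGraphLocallyFinite` derives from boundedness of all
Voronoi cells.

* `voronoiCell_subset_closedBall_of_orthants` — deterministic: if every open coordinate orthant at `p`
  contains a site of `ω`, the Voronoi cell of `p` is bounded (explicit radius);
* `measure_count_orthant_eq_zero`, `ae_forall_orthant_nonempty` — under a homogeneous Poisson process
  of intensity `t · Lebesgue`, `t ≠ 0`, on `ℝᵈ` (`d ≥ 1`), almost surely EVERY open orthant at EVERY
  point of space contains a site (void probabilities `e^{-t m^d} → 0` of growing boxes at the points
  of a countable dense set; Kingman 1993 §2.1);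
* `ae_forall_voronoiCell_bounded`, `ae_forall_finite_neighborSet` — hence a.s. all Voronoi cells are
  bounded and the Delaunay graph `ξ.delaunayGraph` is locally finite.

No definitions, no named facts.
-/

noncomputable section

open MeasureTheory Set Metric Filter Topology
open scoped ENNReal NNReal
open Literature.Analysis.FunctionSpaces

namespace Literature.Probability.LatticeModels

variable {d : ℕ}

/-! ### Deterministic: sites in all orthants bound the Voronoi cell -/

/-- `|±1| = 1` for the sign attached to a Boolean. [folklore] -/
theorem abs_boolSign (b : Bool) : |(if b then (1:ℝ) else -1)| = 1 := by
  cases b <;> simp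

/-- **Sites in every open orthant bound the Voronoi cell.** If for every sign pattern `s` some site
`z ∈ ω` lies in the open orthant `{z | sᵢ (zᵢ - pᵢ) > 0 ∀ i}` at `p`, then the Voronoi cell of `p` is
contained in a closed ball around `p`: for `x` in the cell and `z` the site in the orthant of `x - p`,
`2⟪x - p, z - p⟫ ≤ ‖z - p‖²` while `⟪x - p, z - p⟫ ≥ (minᵢ |zᵢ - pᵢ|) ‖x - p‖`. [folklore] -/
theorem voronoiCell_subset_closedBall_of_orthants (hd : 0 < d) {ω : Set (EuclideanSpace ℝ (Fin d))}
    {p : EuclideanSpace ℝ (Fin d)}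
    (h : ∀ s : Fin d → Bool, ∃ z ∈ ω, ∀ i, 0 < (if s i then (1:ℝ) else -1) * (z i - p i)) :
    ∃ R : ℝ, voronoiCell ω p ⊆ closedBall p R := by
  haveI : Nonempty (Fin d) := ⟨⟨0, hd⟩⟩
  choose z hz hpos using h
  -- the margin of the site `z s` inside its orthant
  let m : (Fin d → Bool) → ℝ := fun s => Finset.univ.inf' Finset.univ_nonempty fun i => |z s i - p i|
  have hm : ∀ s, 0 < m s := fun s => by
    simp only [m, Finset.lt_inf'_iff, Finset.mem_univ, forall_true_left]
    intro i
    have := hpos s i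
    exact abs_pos.2 fun h0 => by rw [h0, mul_zero] at this; exact lt_irrefl _ this
  have hmle : ∀ s i, m s ≤ |z s i - p i| := fun s i =>
    Finset.inf'_le (fun i => |z s i - p i|) (Finset.mem_univ i)
  refine ⟨∑ s, ‖z s - p‖ ^ 2 / (2 * m s), fun x hx => ?_⟩
  rw [mem_closedBall, dist_eq_norm]
  set v : EuclideanSpace ℝ (Fin d) := x - p with hv
  -- the orthant of `v` and its site
  let s : Fin d → Bool := fun i => decide (0 ≤ v i)
  set w : EuclideanSpace ℝ (Fin d) := z s - p with hw
  have hwi : ∀ i, w i = z s i - p i := fun i => by rw [hw]; rfl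
  -- coordinatewise `vᵢ wᵢ = |vᵢ| |wᵢ|`
  have hvw : ∀ i, v i * w i = |v i| * |w i| := by
    intro i
    have hsign := hpos s i
    rw [← hwi] at hsign
    by_cases hi : 0 ≤ v i
    · have hsi : s i = true := by simp [s, hi]
      rw [hsi, if_pos rfl, one_mul] at hsign
      rw [abs_of_nonneg hi, abs_of_pos hsign]
    · have hsi : s i = false := by simp [s, hi]
      rw [hsi] at hsign
      simp only [Bool.false_eq_true, ↓reduceIte, neg_mul, one_mul, Left.neg_pos_iff] at hsign
      push Not at hi
      rw [abs_of_neg hi, abs_of_neg hsign]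
      ring
  -- the cell inequality against the site `z s`: `2⟪v, w⟫ ≤ ‖w‖²`
  have hcell : 2 * inner ℝ v w ≤ ‖w‖ ^ 2 := by
    have h2 : x - z s = v - w := by rw [hv, hw]; abel
    have h1 : ‖v‖ ≤ ‖v - w‖ := by
      have := hx (z s) (hz s)
      rw [dist_eq_norm, dist_eq_norm, h2, ← hv] at this
      exact this
    have h3 : ‖v‖ ^ 2 ≤ ‖v - w‖ ^ 2 := pow_le_pow_left₀ (norm_nonneg _) h1 2
    rw [norm_sub_sq_real (x := v) (y := w)] at h3
    linarith
  -- `⟪v, w⟫ = ∑ |vᵢ||wᵢ| ≥ m ∑ |vᵢ| ≥ m ‖v‖`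
  have hinner : inner ℝ v w = ∑ i, |v i| * |w i| := by
    rw [PiLp.inner_apply]
    refine Finset.sum_congr rfl fun i _ => ?_
    rw [← hvw i]
    simp [mul_comm]
  have hl1 : ‖v‖ ≤ ∑ i, |v i| := by
    have hns : ‖v‖ ^ 2 = ∑ i, |v i| ^ 2 := by
      rw [EuclideanSpace.norm_eq, Real.sq_sqrt (Finset.sum_nonneg fun i _ => by positivity)]
      simp [Real.norm_eq_abs]
    have hsq : ‖v‖ ^ 2 ≤ (∑ i, |v i|) ^ 2 := by
      rw [hns]
      exact Finset.sum_sq_le_sq_sum_of_nonneg fun i _ => abs_nonneg _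
    exact (pow_le_pow_iff_left₀ (norm_nonneg v) (Finset.sum_nonneg fun i _ => abs_nonneg _)
      two_ne_zero).1 hsq
  have hge : m s * ‖v‖ ≤ inner ℝ v w := by
    rw [hinner]
    calc m s * ‖v‖ ≤ m s * ∑ i, |v i| := mul_le_mul_of_nonneg_left hl1 (hm s).le
      _ = ∑ i, |v i| * m s := by rw [Finset.mul_sum]; exact Finset.sum_congr rfl fun i _ => mul_comm _ _
      _ ≤ ∑ i, |v i| * |w i| := Finset.sum_le_sum fun i _ =>
          mul_le_mul_of_nonneg_left ((hwi i).symm ▸ hmle s i) (abs_nonneg _)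
  -- conclude: `‖v‖ ≤ ‖w‖² / (2 m s) ≤ R`
  have hvle : ‖v‖ ≤ ‖w‖ ^ 2 / (2 * m s) := by
    rw [le_div_iff₀ (by linarith [hm s]), mul_comm]
    linarith
  refine hvle.trans ?_
  rw [hw]
  exact Finset.single_le_sum (f := fun s => ‖z s - p‖ ^ 2 / (2 * m s))
    (fun s _ => div_nonneg (sq_nonneg _) (by linarith [hm s])) (Finset.mem_univ s)

/-! ### Homogeneous Poisson processes put sites in every orthant -/

section Poisson

variable {P : Measure (PointConfig (EuclideanSpace ℝ (Fin d)))} {t : ℝ≥0}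

/-- The open orthant at `c` with sign pattern `s`. It is an open, hence measurable, set. [folklore] -/
theorem isOpen_orthant (c : EuclideanSpace ℝ (Fin d)) (s : Fin d → Bool) :
    IsOpen {z : EuclideanSpace ℝ (Fin d) | ∀ i, 0 < (if s i then (1:ℝ) else -1) * (z i - c i)} := by
  simp only [Set.setOf_forall]
  refine isOpen_iInter_of_finite fun i => isOpen_lt continuous_const ?_
  exact continuous_const.mul (((EuclideanSpace.proj i).continuous).sub continuous_const)

/-- The box of side `m` in the orthant: `{z | zᵢ ∈ (cᵢ, cᵢ + m) if sᵢ, zᵢ ∈ (cᵢ - m, cᵢ) else}`, the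
preimage under `ofLp` of a product of intervals; its Lebesgue measure is `m^d`. [folklore] -/
theorem volume_orthantBox (c : EuclideanSpace ℝ (Fin d)) (s : Fin d → Bool) (m : ℝ) :
    volume ((WithLp.ofLp : EuclideanSpace ℝ (Fin d) → (Fin d → ℝ)) ⁻¹'
      Set.pi Set.univ (fun i => if s i then Ioo (c i) (c i + m) else Ioo (c i - m) (c i))) =
      ENNReal.ofReal m ^ d := by
  rw [(PiLp.volume_preserving_ofLp (Fin d)).measure_preimage
    (MeasurableSet.univ_pi fun i => ?_).nullMeasurableSet, volume_pi_pi]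
  · have : ∀ i : Fin d, volume (if s i then Ioo (c i) (c i + m) else Ioo (c i - m) (c i)) =
        ENNReal.ofReal m := fun i => by
      split_ifs <;> simp [Real.volume_Ioo]
    simp only [this, Finset.prod_const, Finset.card_univ, Fintype.card_fin]
  · split_ifs <;> exact measurableSet_Ioo

/-- The box lies in the orthant. [folklore] -/
theorem orthantBox_subset_orthant (c : EuclideanSpace ℝ (Fin d)) (s : Fin d → Bool) (m : ℝ) :
    ((WithLp.ofLp : EuclideanSpace ℝ (Fin d) → (Fin d → ℝ)) ⁻¹'
      Set.pi Set.univ (fun i => if s i then Ioo (c i) (c i + m) else Ioo (c i - m) (c i))) ⊆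
      {z : EuclideanSpace ℝ (Fin d) | ∀ i, 0 < (if s i then (1:ℝ) else -1) * (z i - c i)} := by
  intro z hz i
  have hzi := hz i (Set.mem_univ i)
  change (WithLp.ofLp z) i ∈ (if s i then Ioo (c i) (c i + m) else Ioo (c i - m) (c i)) at hzi
  cases hsi : s i
  · rw [hsi] at hzi
    simp only [Bool.false_eq_true, ↓reduceIte, mem_Ioo] at hzi ⊢
    have : (WithLp.ofLp z) i = z i := rfl
    nlinarith [hzi.2]
  · rw [hsi] at hzi
    simp only [↓reduceIte, mem_Ioo, one_mul, sub_pos] at hzi ⊢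
    exact hzi.1

/-- **An open orthant is a.s. occupied**: under a Poisson process of intensity `t · Lebesgue`,
`t ≠ 0`, `d ≥ 1`, the probability that the open orthant at `c` with sign pattern `s` contains no site
is `0` — it is at most the void probability `e^{-t m^d}` of the box of side `m`, for every `m`
(Kingman 1993, §2.1). [cite: Kingman1993, §2.1] -/
theorem measure_count_orthant_eq_zero (hd : 0 < d) (ht : t ≠ 0)
    (hP : IsPoissonPointProcess (t • (volume : Measure (EuclideanSpace ℝ (Fin d)))) P)
    (c : EuclideanSpace ℝ (Fin d)) (s : Fin d → Bool) :
    P {ω : PointConfig (EuclideanSpace ℝ (Fin d)) | ω.count {z : EuclideanSpace ℝ (Fin d) |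
      ∀ i, 0 < (if s i then (1:ℝ) else -1) * (z i - c i)} = 0} = 0 := by
  set O := {z : EuclideanSpace ℝ (Fin d) | ∀ i, 0 < (if s i then (1:ℝ) else -1) * (z i - c i)}
  let B : ℕ → Set (EuclideanSpace ℝ (Fin d)) := fun m =>
    (WithLp.ofLp : EuclideanSpace ℝ (Fin d) → (Fin d → ℝ)) ⁻¹'
      Set.pi Set.univ (fun i => if s i then Ioo (c i) (c i + m) else Ioo (c i - m) (c i))
  have hBm : ∀ m : ℕ, MeasurableSet (B m) := fun m =>
    (WithLp.measurable_ofLp (p := 2) (X := Fin d → ℝ)) (MeasurableSet.univ_pi fun i => by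
      split_ifs <;> exact measurableSet_Ioo)
  have hvol : ∀ m : ℕ, (t • (volume : Measure (EuclideanSpace ℝ (Fin d)))) (B m) =
      t * ENNReal.ofReal m ^ d := fun m => by
    rw [Measure.smul_apply, volume_orthantBox c s m, ENNReal.smul_def, smul_eq_mul]
  have hfin : ∀ m : ℕ, (t • (volume : Measure (EuclideanSpace ℝ (Fin d)))) (B m) ≠ ∞ := fun m => by
    rw [hvol]
    exact ENNReal.mul_ne_top ENNReal.coe_ne_top (ENNReal.pow_ne_top ENNReal.ofReal_ne_top)
  -- `{N(O) = 0} ⊆ {N(B m) = 0}` and the latter has probability `e^{-t m^d}`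
  have hle : ∀ m : ℕ, P {ω : PointConfig (EuclideanSpace ℝ (Fin d)) | ω.count O = 0} ≤
      ENNReal.ofReal (Real.exp (-(t * m ^ d))) := by
    intro m
    have hsub : {ω : PointConfig (EuclideanSpace ℝ (Fin d)) | ω.count O = 0} ⊆
        {ω | ω.count (B m) = 0} := fun ω hω => by
      have := ω.count_mono (orthantBox_subset_orthant c s m)
      simp only [Set.mem_setOf_eq] at hω ⊢
      exact nonpos_iff_eq_zero.1 (hω ▸ this)
    refine (measure_mono hsub).trans ?_
    rw [hP.measure_count_eq_zero (hBm m) (hfin m), hvol, ENNReal.toReal_mul, ENNReal.coe_toReal,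
      ENNReal.toReal_pow, ENNReal.toReal_ofReal (Nat.cast_nonneg m)]
  -- and `e^{-t m^d} → 0`
  have hlim : Tendsto (fun m : ℕ => ENNReal.ofReal (Real.exp (-(t * m ^ d)))) atTop (𝓝 0) := by
    rw [← ENNReal.ofReal_zero]
    refine ENNReal.tendsto_ofReal (Real.tendsto_exp_atBot.comp ?_)
    refine tendsto_neg_atTop_atBot.comp (Tendsto.const_mul_atTop (by positivity) ?_)
    exact (tendsto_pow_atTop hd.ne').comp tendsto_natCast_atTop_atTop
  exact le_antisymm (ge_of_tendsto' hlim hle) bot_le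

/-- **A.s. every open orthant at every point of space contains a site** (homogeneous Poisson process,
`t ≠ 0`, `d ≥ 1`): the countably many orthants at the points of a countable dense set are a.s. all
occupied, and the orthant at `p` contains the orthant at any `c` inside it. [cite: Kingman1993, §2.1] -/
theorem ae_forall_orthant_nonempty (hd : 0 < d) (ht : t ≠ 0)
    (hP : IsPoissonPointProcess (t • (volume : Measure (EuclideanSpace ℝ (Fin d)))) P) :
    ∀ᵐ ω ∂P, ∀ (p : EuclideanSpace ℝ (Fin d)) (s : Fin d → Bool),
      ∃ z ∈ ((ω : PointConfig (EuclideanSpace ℝ (Fin d))) : Set (EuclideanSpace ℝ (Fin d))),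
        ∀ i, 0 < (if s i then (1:ℝ) else -1) * (z i - p i) := by
  obtain ⟨D, hDc, hDd⟩ := TopologicalSpace.exists_countable_dense (EuclideanSpace ℝ (Fin d))
  haveI : Countable ↥D := hDc.to_subtype
  have hae : ∀ᵐ ω ∂P, ∀ (c : ↥D) (s : Fin d → Bool),
      (ω : PointConfig (EuclideanSpace ℝ (Fin d))).count {z : EuclideanSpace ℝ (Fin d) |
        ∀ i, 0 < (if s i then (1:ℝ) else -1) * (z i - (c : EuclideanSpace ℝ (Fin d)) i)} ≠ 0 := by
    rw [ae_all_iff]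
    intro c
    rw [ae_all_iff]
    intro s
    rw [ae_iff]
    simpa only [not_not] using measure_count_orthant_eq_zero hd ht hP (c : EuclideanSpace ℝ (Fin d)) s
  filter_upwards [hae] with ω hω p s
  -- a point of `D` in the open orthant at `p`
  obtain ⟨c, hcD, hcO⟩ := hDd.exists_mem_open (isOpen_orthant p s)
    ⟨p + (WithLp.toLp 2 fun i => if s i then (1:ℝ) else -1), fun i => by
      have : (p + (WithLp.toLp 2 fun i => if s i then (1:ℝ) else -1)) i - p i =
          (if s i then (1:ℝ) else -1) := by
        show p i + (if s i then (1:ℝ) else -1) - p i = _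
        ring
      rw [this]
      cases s i <;> simp⟩
  have hne := hω ⟨c, hcD⟩ s
  rw [PointConfig.count, Ne, Set.encard_eq_zero, ← Ne, ← Set.nonempty_iff_ne_empty] at hne
  obtain ⟨z, hzω, hzO⟩ := hne
  refine ⟨z, hzω, fun i => ?_⟩
  have h1 := hzO i
  have h2 := hcO i
  -- `sᵢ (zᵢ - pᵢ) = sᵢ (zᵢ - cᵢ) + sᵢ (cᵢ - pᵢ) > 0`
  have : (if s i then (1:ℝ) else -1) * (z i - p i) =
      (if s i then (1:ℝ) else -1) * (z i - c i) + (if s i then (1:ℝ) else -1) * (c i - p i) := by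
    ring
  rw [this]
  exact add_pos h1 h2

/-- **Poisson–Voronoi cells are a.s. bounded**: under a homogeneous Poisson process of intensity
`t · Lebesgue` on `ℝᵈ`, `t ≠ 0`, `d ≥ 1`, almost surely the Voronoi cell of EVERY point (in particular
of every site) is bounded. [cite: Kingman1993, §2.1] -/
theorem ae_forall_voronoiCell_bounded (hd : 0 < d) (ht : t ≠ 0)
    (hP : IsPoissonPointProcess (t • (volume : Measure (EuclideanSpace ℝ (Fin d)))) P) :
    ∀ᵐ ω ∂P, ∀ p : EuclideanSpace ℝ (Fin d), ∃ R : ℝ,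
      voronoiCell ((ω : PointConfig (EuclideanSpace ℝ (Fin d))) : Set (EuclideanSpace ℝ (Fin d))) p ⊆
        closedBall p R := by
  filter_upwards [ae_forall_orthant_nonempty hd ht hP] with ω hω p
  exact voronoiCell_subset_closedBall_of_orthants hd (hω p)

/-- **The Poisson–Delaunay graph is a.s. locally finite** (homogeneous intensity `t ≠ 0`, `d ≥ 1`):
every site has finitely many Delaunay neighbours (`finite_neighborSet`: bounded cell + finitely many
sites in balls), so the finite-volume Gibbs expectations `finVolExpect` on it are genuine.
[cite: Kingman1993, §2.1] -/
theorem ae_forall_finite_neighborSet (hd : 0 < d) (ht : t ≠ 0)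
    (hP : IsPoissonPointProcess (t • (volume : Measure (EuclideanSpace ℝ (Fin d)))) P) :
    ∀ᵐ ω ∂P, ∀ v, ((delaunayGraph ((ω : PointConfig (EuclideanSpace ℝ (Fin d))) :
      Set (EuclideanSpace ℝ (Fin d)))).neighborSet v).Finite := by
  filter_upwards [ae_forall_voronoiCell_bounded hd ht hP] with ω hω v
  obtain ⟨R, hR⟩ := hω v
  exact finite_neighborSet v hR (ω.finite_inter_closedBall _ _)

end Poisson

end Literature.Probability.LatticeModels

end
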